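import Literature.AlgebraicGeometry.HodgeTheory.WeilClassesSixfoldsProofs
import Literature.AlgebraicGeometry.HodgeTheory.LefschetzOneOneHolds
import Literature.AlgebraicGeometry.HodgeTheory.AlgebraicClassesCupAbelianVariety
import Literature.AlgebraicGeometry.HodgeTheory.HodgeTypeExteriorProduct
import Literature.AlgebraicGeometry.HodgeTheory.DegreeOneHodgeTypes
import Literature.AlgebraicGeometry.HodgeTheory.SupportedClassesRationalProofs
import Literature.AlgebraicGeometry.HodgeTheory.HardLefschetzThreefold
import Literature.NumberTheory.Transcendental.DeRhamTheoremMultiplicative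
import Literature.AlgebraicGeometry.Motives.AbelianVarietyCohomologyExteriorH1
import Literature.AlgebraicGeometry.Motives.HyperbolicWeilTypeProduct
import HarnessLib

/-!
# The divisor classes at the diagonal CM point (item stmt-HodgeConjecture-14496, route HeckePrymWeil)

Line `Sketch`, continuation lead c34 — first half of the KEY LEMMA of the Riemann-free closure of the
crux: at the fibre of Deligne's Weil family over the rational diagonal CM point `J_R`
([vanGeemen1994HodgeAV, 5.4–5.7]; [Deligne1982HodgeCycles], proof of Thm. 4.8 (b), p. 50, the point
"`A₀ ⊗ E`") the strong Weil plane consists of ALGEBRAIC classes, WITHOUT identifying the fibre with a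
tensor point up to isogeny (which is where Riemann's theorem / fullness [F] enters the reduction
`HodgeTheory/WeilFamilyLevelStructureOfPeriodConstruction`).

Setting (all hypotheses explicit, no definition): `(Y, Ψ)` a complex abelian `2k`-fold with
`Ψ ≫ Ψ = -p`; `Pr` an idempotent of `H¹(Y(ℂ); ℂ)` commuting with `Ψ^*` and carrying rational classes
to rational classes (the projector onto `P` along `N` of the rational splitting `H¹(Y, ℚ) = P ⊕ N`
transported from the period datum); and the CM condition on `V₊ = ker(Ψ^* - i√p)`:
`im Pr ∩ V₊ ⊆ H^{0,1}`, `ker Pr ∩ V₊ ⊆ H^{1,0}`. Then: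

* `cm_conjClass_apply`, `cm_range_inf_eigenspace_neg_le`, `cm_ker_inf_eigenspace_neg_le` — `Pr`
  commutes with conjugation, so on `V₋ = conj V₊` the types are swapped;
* `cm_cupProduct_mem_algebraicClasses_one_of_decomp` — for RATIONAL `x = x₁ + x₂ ∈ im Pr`,
  `y = y₁ + y₂ ∈ ker Pr` decomposed along `H¹ = V₊ ⊕ V₋`, the class `x₁ ∪ y₁` is algebraic:
  `p·(x ∪ y) - Ψ^*x ∪ Ψ^*y = 2p(x₁ ∪ y₁ + x₂ ∪ y₂)` and `Ψ^*x ∪ y + x ∪ Ψ^*y = 2i√p(x₁ ∪ y₁ - x₂ ∪ y₂)`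
  are rational of Hodge type `(1,1)` (cup product adds Hodge types — the tree's theorem from the
  multiplicative de Rham theorem `exists_deRhamIsoFamily_holds`), hence algebraic by the tree's
  DISCHARGED Lefschetz theorem on `(1,1)`-classes `lefschetzOneOne_rational_holds`;
* `cm_cupProduct_mem_algebraicClasses_one` — hence `a ∪ c` is algebraic for all `a ∈ im Pr ∩ V₊`,
  `c ∈ ker Pr ∩ V₊` (bilinearity; `H¹(Y(ℂ); ℂ)` is spanned by rational classes,
  `span_isRationalClass_eq_top_of_isSmoothProjective_holds`).

The sequel (`…CMAnchorWeilLine`) multiplies `k` such classes into a non-zero algebraic generator of the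
Weil line `⋀^{2k} V₊` (Kleiman moving by translations, `AbelianVariety.cupProduct_mem_algebraicClasses_one`).
No definition, no `sorry`, no named fact taken as hypothesis.
-/

noncomputable section

-- every declaration of this problem lives in `Summit.HodgeConjecture.HodgeConjecture.…` (summit = sub-problem)
set_option linter.dupNamespace false

open CategoryTheory AlgebraicGeometry Limits
open Literature.AlgebraicTopology.SingularHomology

namespace Summit.HodgeConjecture.HodgeConjecture.Theorems.HeckePrymWeilLine

open Literature.AlgebraicGeometry Literature.AlgebraicGeometry.Motives Literature.AlgebraicGeometry.HodgeTheory

variable {p k : ℕ} {Y : AbelianVariety ℂ} {Ψ : Y ⟶ Y}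

/-- `conj (i√p) = -i√p`. [folklore] -/
theorem cm_star_I_mul_sqrt (p : ℕ) :
    starRingEnd ℂ (Complex.I * (Real.sqrt p : ℂ)) = -(Complex.I * (Real.sqrt p : ℂ)) := by
  rw [map_mul, Complex.conj_I, Complex.conj_ofReal, neg_mul]

/-- Conjugation carries `ker(Ψ^* - μ)` into `ker(Ψ^* + μ)` for `μ = i√p` (`Ψ^*` is real).
[cite: vanGeemen1994HodgeAV, 5.7] -/
theorem cm_conjClass_mem_eigenspace_neg {v : complexBetti Y.X 1}
    (hv : v ∈ Module.End.eigenspace (complexBetti.map Ψ.hom.hom.hom 1).hom (Complex.I * (Real.sqrt p : ℂ))) :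
    conjClass (ComplexPoints Y.X) 1 v ∈
      Module.End.eigenspace (complexBetti.map Ψ.hom.hom.hom 1).hom (-(Complex.I * (Real.sqrt p : ℂ))) := by
  rw [Module.End.mem_eigenspace_iff] at hv ⊢
  change complexBetti.map Ψ.hom.hom.hom 1 (conjClass (ComplexPoints Y.X) 1 v) = _
  change complexBetti.map Ψ.hom.hom.hom 1 v = _ at hv
  rw [← conjClass_map, hv, conjClass_smul, cm_star_I_mul_sqrt]

/-- Conversely, conjugation carries `ker(Ψ^* + μ)` into `ker(Ψ^* - μ)`. [cite: vanGeemen1994HodgeAV, 5.7] -/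
theorem cm_conjClass_mem_eigenspace_pos {v : complexBetti Y.X 1}
    (hv : v ∈ Module.End.eigenspace (complexBetti.map Ψ.hom.hom.hom 1).hom (-(Complex.I * (Real.sqrt p : ℂ)))) :
    conjClass (ComplexPoints Y.X) 1 v ∈
      Module.End.eigenspace (complexBetti.map Ψ.hom.hom.hom 1).hom (Complex.I * (Real.sqrt p : ℂ)) := by
  rw [Module.End.mem_eigenspace_iff] at hv ⊢
  change complexBetti.map Ψ.hom.hom.hom 1 (conjClass (ComplexPoints Y.X) 1 v) = _
  change complexBetti.map Ψ.hom.hom.hom 1 v = _ at hv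
  rw [← conjClass_map, hv, conjClass_smul, map_neg, cm_star_I_mul_sqrt, neg_neg]

/-- A `ℂ`-linear operator on `H¹(Y(ℂ); ℂ)` carrying rational classes to rational classes commutes
with complex conjugation (rational classes are real and span). [cite: VoisinHodgeI2002, Cor. 6.12 and §7.1.1] -/
theorem cm_conjClass_apply (hY : Y.dim = 2 * k)
    (Pr : complexBetti Y.X 1 →ₗ[ℂ] complexBetti Y.X 1)
    (hPrrat : ∀ x, IsRationalClass x → IsRationalClass (Pr x)) (x : complexBetti Y.X 1) :
    conjClass (ComplexPoints Y.X) 1 (Pr x) = Pr (conjClass (ComplexPoints Y.X) 1 x) := by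
  have hX := Motives.isSmoothProjective_of_dim_eq' hY
  have hspan := span_isRationalClass_eq_top_of_isSmoothProjective_holds (2 * k) Y.X hX 1
  have hx : x ∈ Submodule.span ℂ {c : complexBetti Y.X 1 | IsRationalClass c} := by
    rw [hspan]; exact Submodule.mem_top
  induction hx using Submodule.span_induction with
  | mem r hr => rw [(hPrrat r hr).conjClass_eq, hr.conjClass_eq]
  | zero => rw [map_zero, conjClass_zero, map_zero]
  | add a b _ _ ha hb => rw [map_add, conjClass_add, conjClass_add, map_add, ha, hb]
  | smul c a _ ha => rw [map_smul, conjClass_smul, conjClass_smul, map_smul, ha]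

/-- From the two `CM inclusions` on `V₊ = ker(Ψ^* - i√p)` to the two on `V₋ = ker(Ψ^* + i√p)`, by
conjugation: `im Pr ∩ V₋ ⊆ H^{1,0}`. [cite: vanGeemen1994HodgeAV, 5.7] -/
theorem cm_range_inf_eigenspace_neg_le (hY : Y.dim = 2 * k)
    (Pr : complexBetti Y.X 1 →ₗ[ℂ] complexBetti Y.X 1) (hPr : IsIdempotentElem Pr)
    (hPrrat : ∀ x, IsRationalClass x → IsRationalClass (Pr x))
    (hrange : LinearMap.range Pr ⊓
      Module.End.eigenspace (complexBetti.map Ψ.hom.hom.hom 1).hom (Complex.I * (Real.sqrt p : ℂ)) ≤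
      hodgeZeroOne (Motives.isSmoothProjective_of_dim_eq' hY)) :
    LinearMap.range Pr ⊓
      Module.End.eigenspace (complexBetti.map Ψ.hom.hom.hom 1).hom (-(Complex.I * (Real.sqrt p : ℂ))) ≤
      hodgeOneZero (Motives.isSmoothProjective_of_dim_eq' hY) := by
  intro v hv
  obtain ⟨hvr, hvm⟩ := Submodule.mem_inf.1 hv
  have h1 : conjClass (ComplexPoints Y.X) 1 v ∈ LinearMap.range Pr := by
    rw [LinearMap.IsIdempotentElem.mem_range_iff hPr] at hvr ⊢
    rw [← cm_conjClass_apply hY Pr hPrrat, hvr]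
  have h2 := hrange ⟨h1, cm_conjClass_mem_eigenspace_pos hvm⟩
  have h3 := conjClass_mem_hodgeOneZero (Motives.isSmoothProjective_of_dim_eq' hY) h2
  rwa [conjClass_conjClass] at h3

/-- `ker Pr ∩ V₋ ⊆ H^{0,1}`. [cite: vanGeemen1994HodgeAV, 5.7] -/
theorem cm_ker_inf_eigenspace_neg_le (hY : Y.dim = 2 * k)
    (Pr : complexBetti Y.X 1 →ₗ[ℂ] complexBetti Y.X 1)
    (hPrrat : ∀ x, IsRationalClass x → IsRationalClass (Pr x))
    (hker : LinearMap.ker Pr ⊓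
      Module.End.eigenspace (complexBetti.map Ψ.hom.hom.hom 1).hom (Complex.I * (Real.sqrt p : ℂ)) ≤
      hodgeOneZero (Motives.isSmoothProjective_of_dim_eq' hY)) :
    LinearMap.ker Pr ⊓
      Module.End.eigenspace (complexBetti.map Ψ.hom.hom.hom 1).hom (-(Complex.I * (Real.sqrt p : ℂ))) ≤
      hodgeZeroOne (Motives.isSmoothProjective_of_dim_eq' hY) := by
  intro v hv
  obtain ⟨hvk, hvm⟩ := Submodule.mem_inf.1 hv
  have h1 : conjClass (ComplexPoints Y.X) 1 v ∈ LinearMap.ker Pr := by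
    rw [LinearMap.mem_ker] at hvk ⊢
    rw [← cm_conjClass_apply hY Pr hPrrat, hvk, conjClass_zero]
  have h2 := hker ⟨h1, cm_conjClass_mem_eigenspace_pos hvm⟩
  have h3 := conjClass_mem_hodgeZeroOne (Motives.isSmoothProjective_of_dim_eq' hY) h2
  rwa [conjClass_conjClass] at h3


/-- **The divisor classes at the CM point.** Let `(Y, Ψ)` be an abelian `2k`-fold with
`Ψ ≫ Ψ = -p`, `Pr` an idempotent of `H¹(Y(ℂ); ℂ)` defined over `ℚ` and commuting with `Ψ^*`, such
that on `V₊ = ker(Ψ^* - i√p)` the image of `Pr` is of type `(0,1)` and the kernel of type `(1,0)`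
(the period point is the diagonal CM point `B × B̄`). If `x = x₁ + x₂`, `y = y₁ + y₂` are RATIONAL
classes decomposed along `H¹ = V₊ ⊕ V₋` with `Pr x = x`, `Pr y = 0`, then `x₁ ∪ y₁` is ALGEBRAIC:
`p·(x ∪ y) - Ψ^*x ∪ Ψ^*y = 2p (x₁ ∪ y₁ + x₂ ∪ y₂)` and `Ψ^*x ∪ y + x ∪ Ψ^*y = 2i√p (x₁ ∪ y₁ - x₂ ∪ y₂)`
are rational of Hodge type `(1,1)`, hence algebraic by the Lefschetz theorem on `(1,1)`-classes
(`lefschetzOneOne_rational_holds`), and `x₁ ∪ y₁` is a complex combination of them.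
[cite: Deligne1982HodgeCycles, Lemma 4.5 and proof of Thm. 4.8 (b), p. 50]
[cite: vanGeemen1994HodgeAV, 5.7] [cite: VoisinHodgeI2002, Thm. 11.30] -/
theorem cm_cupProduct_mem_algebraicClasses_one_of_decomp (hp : 0 < p) (hY : Y.dim = 2 * k)
    (hΨ : Ψ ≫ Ψ = -(p • 𝟙 Y))
    (Pr : complexBetti Y.X 1 →ₗ[ℂ] complexBetti Y.X 1) (hPr : IsIdempotentElem Pr)
    (hPrT : Pr ∘ₗ (complexBetti.map Ψ.hom.hom.hom 1).hom = (complexBetti.map Ψ.hom.hom.hom 1).hom ∘ₗ Pr)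
    (hPrrat : ∀ x, IsRationalClass x → IsRationalClass (Pr x))
    (hrange : LinearMap.range Pr ⊓
      Module.End.eigenspace (complexBetti.map Ψ.hom.hom.hom 1).hom (Complex.I * (Real.sqrt p : ℂ)) ≤
      hodgeZeroOne (Motives.isSmoothProjective_of_dim_eq' hY))
    (hker : LinearMap.ker Pr ⊓
      Module.End.eigenspace (complexBetti.map Ψ.hom.hom.hom 1).hom (Complex.I * (Real.sqrt p : ℂ)) ≤
      hodgeOneZero (Motives.isSmoothProjective_of_dim_eq' hY))
    {x₁ x₂ y₁ y₂ : complexBetti Y.X 1}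
    (hx₁ : x₁ ∈ Module.End.eigenspace (complexBetti.map Ψ.hom.hom.hom 1).hom (Complex.I * (Real.sqrt p : ℂ)))
    (hx₂ : x₂ ∈ Module.End.eigenspace (complexBetti.map Ψ.hom.hom.hom 1).hom (-(Complex.I * (Real.sqrt p : ℂ))))
    (hy₁ : y₁ ∈ Module.End.eigenspace (complexBetti.map Ψ.hom.hom.hom 1).hom (Complex.I * (Real.sqrt p : ℂ)))
    (hy₂ : y₂ ∈ Module.End.eigenspace (complexBetti.map Ψ.hom.hom.hom 1).hom (-(Complex.I * (Real.sqrt p : ℂ))))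
    (hx : IsRationalClass (x₁ + x₂)) (hxP : Pr (x₁ + x₂) = x₁ + x₂)
    (hy : IsRationalClass (y₁ + y₂)) (hyP : Pr (y₁ + y₂) = 0) :
    cupProduct (show 1 + 1 = 2 * 1 by rfl) x₁ y₁ ∈ algebraicClasses Y.X 1 := by
  have hX := Motives.isSmoothProjective_of_dim_eq' hY
  set T := (complexBetti.map Ψ.hom.hom.hom 1).hom with hT
  set μ : ℂ := Complex.I * (Real.sqrt p : ℂ) with hμ
  have hμ0 : μ ≠ 0 := I_mul_sqrt_ne_zero hp
  have hμμ : μ * μ = -(p : ℂ) := by rw [← pow_two, hμ, I_mul_sqrt_sq]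
  have hp0 : (p : ℂ) ≠ 0 := Nat.cast_ne_zero.2 hp.ne'
  have hdisj : Module.End.eigenspace T μ ⊓ Module.End.eigenspace T (-μ) = ⊥ :=
    (isCompl_eigenspace_eigenspace_neg hp hΨ).inf_eq_bot
  -- `Pr` commutes with `T`, hence preserves `V₊` and `V₋`
  have hPT : ∀ z, Pr (T z) = T (Pr z) := fun z => LinearMap.congr_fun hPrT z
  have hTx₁ : T x₁ = μ • x₁ := Module.End.mem_eigenspace_iff.1 hx₁
  have hTx₂ : T x₂ = (-μ) • x₂ := Module.End.mem_eigenspace_iff.1 hx₂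
  have hTy₁ : T y₁ = μ • y₁ := Module.End.mem_eigenspace_iff.1 hy₁
  have hTy₂ : T y₂ = (-μ) • y₂ := Module.End.mem_eigenspace_iff.1 hy₂
  have hPmem : ∀ (ν : ℂ) (z : complexBetti Y.X 1), z ∈ Module.End.eigenspace T ν →
      Pr z ∈ Module.End.eigenspace T ν := by
    intro ν z hz
    rw [Module.End.mem_eigenspace_iff] at hz ⊢
    rw [← hPT, hz, map_smul]
  -- `Pr x₁ = x₁`, `Pr x₂ = x₂`, `Pr y₁ = 0`, `Pr y₂ = 0`
  have hzero : ∀ z, z ∈ Module.End.eigenspace T μ → z ∈ Module.End.eigenspace T (-μ) → z = 0 := by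
    intro z h1 h2
    have h : z ∈ Module.End.eigenspace T μ ⊓ Module.End.eigenspace T (-μ) := Submodule.mem_inf.2 ⟨h1, h2⟩
    rwa [hdisj, Submodule.mem_bot] at h
  have hPx₁ : Pr x₁ = x₁ := by
    have h1 : Pr x₁ - x₁ ∈ Module.End.eigenspace T μ := Submodule.sub_mem _ (hPmem μ x₁ hx₁) hx₁
    have h2 : Pr x₁ - x₁ ∈ Module.End.eigenspace T (-μ) := by
      have e : Pr x₁ - x₁ = -(Pr x₂ - x₂) := by
        rw [map_add] at hxP
        rw [neg_sub, sub_eq_sub_iff_add_eq_add, hxP, add_comm]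
      rw [e]
      exact Submodule.neg_mem _ (Submodule.sub_mem _ (hPmem _ x₂ hx₂) hx₂)
    exact sub_eq_zero.1 (hzero _ h1 h2)
  have hPx₂ : Pr x₂ = x₂ := by
    rw [map_add, hPx₁, add_right_inj] at hxP
    exact hxP
  have hPy₁ : Pr y₁ = 0 := by
    have h2 : Pr y₁ ∈ Module.End.eigenspace T (-μ) := by
      have e : Pr y₁ = -Pr y₂ := by
        rw [map_add] at hyP
        exact eq_neg_of_add_eq_zero_left hyP
      rw [e]
      exact Submodule.neg_mem _ (hPmem _ y₂ hy₂)
    exact hzero _ (hPmem μ y₁ hy₁) h2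
  have hPy₂ : Pr y₂ = 0 := by
    rw [map_add, hPy₁, zero_add] at hyP
    exact hyP
  -- Hodge types of the four pieces
  have hx₁t : x₁ ∈ hodgeZeroOne hX :=
    hrange (Submodule.mem_inf.2 ⟨LinearMap.mem_range.2 ⟨x₁, hPx₁⟩, hx₁⟩)
  have hx₂t : x₂ ∈ hodgeOneZero hX :=
    cm_range_inf_eigenspace_neg_le hY Pr hPr hPrrat hrange
      (Submodule.mem_inf.2 ⟨LinearMap.mem_range.2 ⟨x₂, hPx₂⟩, hx₂⟩)
  have hy₁t : y₁ ∈ hodgeOneZero hX :=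
    hker (Submodule.mem_inf.2 ⟨LinearMap.mem_ker.2 hPy₁, hy₁⟩)
  have hy₂t : y₂ ∈ hodgeZeroOne hX :=
    cm_ker_inf_eigenspace_neg_le hY Pr hPrrat hker (Submodule.mem_inf.2 ⟨LinearMap.mem_ker.2 hPy₂, hy₂⟩)
  have hcup : CupPreservesHodgeType (2 * k) Y.X :=
    cupPreservesHodgeType_of_multiplicative_deRham
      (fun E _ _ _ ↦ Literature.NumberTheory.Transcendental.exists_deRhamIsoFamily_holds E) hX
  have h11 : 1 + 1 = 2 * 1 := rfl
  -- types `(0,1) + (1,0)` and `(1,0) + (0,1)`, i.e. `(1,1)` (elaborate first, then unify the degrees)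
  have ht₁ : IsOfHodgeType (2 * k) Y.X (2 * 1) 1 1 (cupProduct h11 x₁ y₁) := by
    have h := hcup h11 ((mem_hodgeZeroOne hX).1 hx₁t) ((mem_hodgeOneZero hX).1 hy₁t)
    exact h
  have ht₂ : IsOfHodgeType (2 * k) Y.X (2 * 1) 1 1 (cupProduct h11 x₂ y₂) := by
    have h := hcup h11 ((mem_hodgeOneZero hX).1 hx₂t) ((mem_hodgeZeroOne hX).1 hy₂t)
    exact h
  -- the two rational `(1,1)`-classes
  have hTx : T (x₁ + x₂) = μ • x₁ + (-μ) • x₂ := by rw [map_add, hTx₁, hTx₂]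
  have hTy : T (y₁ + y₂) = μ • y₁ + (-μ) • y₂ := by rw [map_add, hTy₁, hTy₂]
  have hu : (p : ℂ) • cupProduct h11 (x₁ + x₂) (y₁ + y₂) - cupProduct h11 (T (x₁ + x₂)) (T (y₁ + y₂)) =
      (2 * (p : ℂ)) • (cupProduct h11 x₁ y₁ + cupProduct h11 x₂ y₂) := by
    rw [hTx, hTy]
    simp only [map_add, map_smul, LinearMap.add_apply, LinearMap.smul_apply, smul_add, smul_smul,
      mul_neg, neg_mul, neg_neg, hμμ]
    module
  have hv : cupProduct h11 (T (x₁ + x₂)) (y₁ + y₂) + cupProduct h11 (x₁ + x₂) (T (y₁ + y₂)) =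
      (2 * μ) • (cupProduct h11 x₁ y₁ - cupProduct h11 x₂ y₂) := by
    rw [hTx, hTy]
    simp only [map_add, map_smul, LinearMap.add_apply, LinearMap.smul_apply, smul_add]
    module
  have hTrat : ∀ z : complexBetti Y.X 1, IsRationalClass z → IsRationalClass (T z) := fun z hz =>
    hz.map (Motives.AlgPoints.mapContinuous (L := ℂ) Ψ.hom.hom.hom)
  have hu_rat : IsRationalClass ((p : ℂ) • cupProduct h11 (x₁ + x₂) (y₁ + y₂) - cupProduct h11 (T (x₁ + x₂)) (T (y₁ + y₂))) := by
    have h := ((hx.cup h11 hy).smul (p : ℚ)).add (((hTrat _ hx).cup h11 (hTrat _ hy)).smul (-1))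
    rwa [Rat.cast_natCast, Rat.cast_neg, Rat.cast_one, neg_one_smul, ← sub_eq_add_neg] at h
  have hv_rat : IsRationalClass (cupProduct h11 (T (x₁ + x₂)) (y₁ + y₂) + cupProduct h11 (x₁ + x₂) (T (y₁ + y₂))) :=
    ((hTrat _ hx).cup _ hy).add (hx.cup _ (hTrat _ hy))
  have hu_alg : (2 * (p : ℂ)) • (cupProduct h11 x₁ y₁ + cupProduct h11 x₂ y₂) ∈ algebraicClasses Y.X 1 := by
    rw [← hu]
    refine lefschetzOneOne_rational_holds hX _ hu_rat ?_
    rw [hu]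
    exact (ht₁.add hX ht₂).smul _
  have hv_alg : (2 * μ) • (cupProduct h11 x₁ y₁ - cupProduct h11 x₂ y₂) ∈ algebraicClasses Y.X 1 := by
    rw [← hv]
    refine lefschetzOneOne_rational_holds hX _ hv_rat ?_
    rw [hv]
    exact (ht₁.sub hX ht₂).smul _
  -- `x₁ ∪ y₁` is a complex combination of them
  have hcomb : cupProduct h11 x₁ y₁ = (4 * (p : ℂ))⁻¹ • ((2 * (p : ℂ)) • (cupProduct h11 x₁ y₁ + cupProduct h11 x₂ y₂)) +
      (4 * μ)⁻¹ • ((2 * μ) • (cupProduct h11 x₁ y₁ - cupProduct h11 x₂ y₂)) := by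
    have e1 : (4 * (p : ℂ))⁻¹ * (2 * p) = 2⁻¹ := by field_simp; ring
    have e2 : (4 * μ)⁻¹ * (2 * μ) = 2⁻¹ := by field_simp; ring
    rw [smul_smul, smul_smul, e1, e2]
    module
  rw [hcomb]
  exact Submodule.add_mem _ (Submodule.smul_mem _ _ hu_alg) (Submodule.smul_mem _ _ hv_alg)

/-- **The divisor classes at the CM point, bilinear form**: in the situation of
`cm_cupProduct_mem_algebraicClasses_one_of_decomp`, `a ∪ c` is algebraic for EVERY
`a ∈ im Pr ∩ V₊` and `c ∈ ker Pr ∩ V₊` — both spaces are spanned by the `V₊`-components of rational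
classes (`H¹(Y(ℂ); ℂ)` is spanned by rational classes and `Pr` is defined over `ℚ`), and the cup
product is bilinear. [cite: Deligne1982HodgeCycles, Lemma 4.5 and proof of Thm. 4.8 (b), p. 50]
[cite: vanGeemen1994HodgeAV, 5.7] -/
theorem cm_cupProduct_mem_algebraicClasses_one (hp : 0 < p) (hY : Y.dim = 2 * k)
    (hΨ : Ψ ≫ Ψ = -(p • 𝟙 Y))
    (Pr : complexBetti Y.X 1 →ₗ[ℂ] complexBetti Y.X 1) (hPr : IsIdempotentElem Pr)
    (hPrT : Pr ∘ₗ (complexBetti.map Ψ.hom.hom.hom 1).hom = (complexBetti.map Ψ.hom.hom.hom 1).hom ∘ₗ Pr)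
    (hPrrat : ∀ x, IsRationalClass x → IsRationalClass (Pr x))
    (hrange : LinearMap.range Pr ⊓
      Module.End.eigenspace (complexBetti.map Ψ.hom.hom.hom 1).hom (Complex.I * (Real.sqrt p : ℂ)) ≤
      hodgeZeroOne (Motives.isSmoothProjective_of_dim_eq' hY))
    (hker : LinearMap.ker Pr ⊓
      Module.End.eigenspace (complexBetti.map Ψ.hom.hom.hom 1).hom (Complex.I * (Real.sqrt p : ℂ)) ≤
      hodgeOneZero (Motives.isSmoothProjective_of_dim_eq' hY))
    {a c : complexBetti Y.X 1}
    (ha : a ∈ LinearMap.range Pr ⊓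
      Module.End.eigenspace (complexBetti.map Ψ.hom.hom.hom 1).hom (Complex.I * (Real.sqrt p : ℂ)))
    (hc : c ∈ LinearMap.ker Pr ⊓
      Module.End.eigenspace (complexBetti.map Ψ.hom.hom.hom 1).hom (Complex.I * (Real.sqrt p : ℂ))) :
    cupProduct (show 1 + 1 = 2 * 1 by rfl) a c ∈ algebraicClasses Y.X 1 := by
  have hX := Motives.isSmoothProjective_of_dim_eq' hY
  have h11 : 1 + 1 = 2 * 1 := rfl
  set T := (complexBetti.map Ψ.hom.hom.hom 1).hom with hT
  set μ : ℂ := Complex.I * (Real.sqrt p : ℂ) with hμ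
  have hcpl : IsCompl (Module.End.eigenspace T μ) (Module.End.eigenspace T (-μ)) :=
    isCompl_eigenspace_eigenspace_neg hp hΨ
  set prj := (Module.End.eigenspace T μ).projection (Module.End.eigenspace T (-μ)) hcpl with hprj
  have hspan := span_isRationalClass_eq_top_of_isSmoothProjective_holds (2 * k) Y.X hX 1
  have hPP : ∀ z, Pr (Pr z) = Pr z := fun z => by rw [← Module.End.mul_apply, hPr.eq]
  -- `im Pr ∩ V₊` and `ker Pr ∩ V₊` are spanned by `V₊`-components of rational classes
  obtain ⟨har, haV⟩ := Submodule.mem_inf.1 ha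
  obtain ⟨hck, hcV⟩ := Submodule.mem_inf.1 hc
  have haS : a ∈ Submodule.span ℂ ((prj ∘ₗ Pr) '' {r : complexBetti Y.X 1 | IsRationalClass r}) := by
    rw [← Submodule.map_span, hspan, Submodule.map_top]
    refine ⟨a, ?_⟩
    rw [LinearMap.comp_apply, (LinearMap.IsIdempotentElem.mem_range_iff hPr).1 har,
      Submodule.projection_apply_of_mem_left hcpl haV]
  have hcS : c ∈ Submodule.span ℂ ((prj ∘ₗ (LinearMap.id - Pr)) '' {r : complexBetti Y.X 1 | IsRationalClass r}) := by
    rw [← Submodule.map_span, hspan, Submodule.map_top]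
    refine ⟨c, ?_⟩
    rw [LinearMap.comp_apply, LinearMap.sub_apply, LinearMap.id_apply, LinearMap.mem_ker.1 hck, sub_zero,
      Submodule.projection_apply_of_mem_left hcpl hcV]
  -- bilinear extension of the rational case
  revert c
  suffices key : ∀ a' ∈ Submodule.span ℂ ((prj ∘ₗ Pr) '' {r : complexBetti Y.X 1 | IsRationalClass r}),
      ∀ c' ∈ Submodule.span ℂ ((prj ∘ₗ (LinearMap.id - Pr)) '' {r : complexBetti Y.X 1 | IsRationalClass r}),
        cupProduct h11 a' c' ∈ algebraicClasses Y.X 1 by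
    intro c hc hck hcV hcS
    exact key a haS c hcS
  intro a' ha'
  induction ha' using Submodule.span_induction with
  | mem x hx =>
    obtain ⟨r, hr, rfl⟩ := hx
    intro c' hc'
    induction hc' using Submodule.span_induction with
    | mem y hy =>
      obtain ⟨r', hr', rfl⟩ := hy
      have e₁ : (prj ∘ₗ Pr) r + (Pr r - prj (Pr r)) = Pr r := by
        rw [LinearMap.comp_apply, add_sub_cancel]
      have e₂ : (prj ∘ₗ (LinearMap.id - Pr)) r' + ((r' - Pr r') - prj (r' - Pr r')) = r' - Pr r' := by
        rw [LinearMap.comp_apply, LinearMap.sub_apply, LinearMap.id_apply, add_sub_cancel]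
      refine cm_cupProduct_mem_algebraicClasses_one_of_decomp hp hY hΨ Pr hPr hPrT hPrrat hrange hker
        (x₂ := Pr r - prj (Pr r)) (y₂ := (r' - Pr r') - prj (r' - Pr r'))
        (Submodule.projection_apply_mem hcpl _) (Submodule.sub_projection_mem hcpl _)
        (Submodule.projection_apply_mem hcpl _) (Submodule.sub_projection_mem hcpl _) ?_ ?_ ?_ ?_
      · rw [e₁]; exact hPrrat r hr
      · rw [e₁, hPP]
      · rw [e₂]
        have h := hr'.add ((hPrrat r' hr').smul (-1))
        rwa [Rat.cast_neg, Rat.cast_one, neg_one_smul, ← sub_eq_add_neg] at h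
      · rw [e₂, map_sub, hPP, sub_self]
    | zero => rw [map_zero]; exact Submodule.zero_mem _
    | add y z _ _ hy hz => rw [map_add]; exact Submodule.add_mem _ hy hz
    | smul t y _ hy => rw [map_smul]; exact Submodule.smul_mem _ _ hy
  | zero => intro c' _; rw [map_zero, LinearMap.zero_apply]; exact Submodule.zero_mem _
  | add y z _ _ hy hz =>
    intro c' hc'
    rw [map_add, LinearMap.add_apply]
    exact Submodule.add_mem _ (hy c' hc') (hz c' hc')
  | smul t y _ hy =>
    intro c' hc'
    rw [map_smul, LinearMap.smul_apply]
    exact Submodule.smul_mem _ _ (hy c' hc')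

/-- **The divisor classes at the diagonal CM point are algebraic** — `cm_cupProduct_mem_algebraicClasses_one`
with every binder displayed (the registered sub-goal of line `Sketch` for this file): for an abelian
`2k`-fold `(Y, Ψ)`, `Ψ ≫ Ψ = -p`, an idempotent `Pr` of `H¹(Y(ℂ); ℂ)` over `ℚ` commuting with `Ψ^*`
with `im Pr ∩ V₊ ⊆ H^{0,1}` and `ker Pr ∩ V₊ ⊆ H^{1,0}`, every `a ∪ c` with `a ∈ im Pr ∩ V₊`,
`c ∈ ker Pr ∩ V₊` lies in `algebraicClasses Y.X 1`.
[cite: Deligne1982HodgeCycles, Lemma 4.5 and proof of Thm. 4.8 (b), p. 50]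
[cite: vanGeemen1994HodgeAV, 5.7] [cite: VoisinHodgeI2002, Thm. 11.30] -/
theorem cm_divisorClasses_algebraic :
    ∀ (p k : ℕ) (Y : AbelianVariety ℂ) (Ψ : Y ⟶ Y) (hp : 0 < p) (hY : Y.dim = 2 * k), Ψ ≫ Ψ = -(p • 𝟙 Y) → ∀ (Pr : complexBetti Y.X 1 →ₗ[ℂ] complexBetti Y.X 1), IsIdempotentElem Pr → Pr ∘ₗ (complexBetti.map Ψ.hom.hom.hom 1).hom = (complexBetti.map Ψ.hom.hom.hom 1).hom ∘ₗ Pr → (∀ x, IsRationalClass x → IsRationalClass (Pr x)) → LinearMap.range Pr ⊓ Module.End.eigenspace (complexBetti.map Ψ.hom.hom.hom 1).hom (Complex.I * (Real.sqrt p : ℂ)) ≤ hodgeZeroOne (Motives.isSmoothProjective_of_dim_eq' hY) → LinearMap.ker Pr ⊓ Module.End.eigenspace (complexBetti.map Ψ.hom.hom.hom 1).hom (Complex.I * (Real.sqrt p : ℂ)) ≤ hodgeOneZero (Motives.isSmoothProjective_of_dim_eq' hY) → ∀ a c : complexBetti Y.X 1, a ∈ LinearMap.range Pr ⊓ Module.End.eigenspace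 (complexBetti.map Ψ.hom.hom.hom 1).hom (Complex.I * (Real.sqrt p : ℂ)) → c ∈ LinearMap.ker Pr ⊓ Module.End.eigenspace (complexBetti.map Ψ.hom.hom.hom 1).hom (Complex.I * (Real.sqrt p : ℂ)) → cupProduct (show 1 + 1 = 2 * 1 by rfl) a c ∈ algebraicClasses Y.X 1 :=
  fun _ _ _ _ hp hY hΨ Pr hPr hPrT hPrrat hrange hker _ _ ha hc =>
    cm_cupProduct_mem_algebraicClasses_one hp hY hΨ Pr hPr hPrT hPrrat hrange hker ha hc

end Summit.HodgeConjecture.HodgeConjecture.Theorems.HeckePrymWeilLine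

end
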